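import Summits.ABC.IUTFork.Joshi.ArithTeichmullerSpacePointed
import Summits.ABC.IUTFork.Joshi.ATS1SpacesBasic
import Summits.ABC.IUTFork.Joshi.ATS1SpacesStructure
import HarnessLib

/-!
# [J-I] Def. 5.1.1 (6)(b) / Rmk. 5.1.2 — ONE predicate, three typings: proof-only bridge (merge-debt E-t1 ↔ E-t19 ↔ E-t21)

Record file of the abc-iut cell, branch E (rung LADDER-ABC:A2.E; seat abc-iut-E-t19, §4-fallback #4 «merge-debt reconciliation»,
ASSIGNMENTS v2.2 §3 interface note 08:10Z «E-t1 ↔ E-t19: Def 5.1.1 (6)(b) typed twice-compatibly»; typer-side audit note N3 on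
p431517). Source of record: Joshi, *Arithmetic Teichmüller Spaces I*, arXiv:2106.11452 **v4**, render
`plan/repair/lit/renders/Joshi-ATS1-2106.11452v4-PDFpaged-book-anonnd/` — Def. 5.1.1 (6)(b) p. 23 l. 1–7, Rmk. 5.1.2 p. 23 l. 10–14
(«In the principal case of hyperbolic curves over p-adic fields … the requirement (b) is implied by (a) (by [Mochizuki, 2004,
Lemma 1.3.8])»), Prop. 5.8.1 (2) p. 29 l. 10–23, Prop. 5.10.1 p. 30 l. 11–17 («`Out(Π)` acts on isomorphism classes»).

THE THREE TYPINGS of clause (6)(b) «any such anabelomorphism induces an anabelomorphism of their geometric tempered fundamental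
subgroups» in the tree, all of the shape `α(Δ^temp_Y) = Δ^temp_X`:
* E-t1 (p431520) `ATSObjPointed.GeomCompatible` on POINTED objects, with Rmk. 5.1.2 = `ATSObjPointed.Rmk512 X 𝔅 F`;
* E-t19 (p431648) `ATSObj.GeomCompatible` on E-t1's base-point-free objects, with Rmk. 5.1.2 = `ATSObj.GeomCompatibleOfAnabelomorphism X`;
* E-t21 (p431517) `ATSObj.PreservesGeomSubgroup IsHyp X` = the same conclusion restricted to `𝔍_hyp(X,E)` (Prop. 5.8.1 (2) input).

WHAT IS HERE (all DERIVED, nothing asserted, no new `Prop`): (i) pointed (6)(b) IS unpointed (6)(b) of the shadow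
(`ATSObjPointed.geomCompatible_iff_toATSObj`, `Iff.rfl`); (ii) E-t19's ∀-form ⟹ E-t1's ∀-form for every Berkovich family `𝔅`
and tilt base `F` (`rmk512_of_geomCompatibleOfAnabelomorphism`), and conversely on any `(𝔅, F)` through which every object lifts
(`geomCompatibleOfAnabelomorphism_of_rmk512`, the lifting hypothesis explicit — in print every object of `𝔍(X,E)` carries SOME
holomorphic structure, but not over a FIXED tilt base `F`); (iii) E-t19's ∀-form ⟺ E-t21's `PreservesGeomSubgroup` at the
trivial hyperbolicity predicate and ⟹ it for every `IsHyp` (`geomCompatibleOfAnabelomorphism_iff_preservesGeomSubgroup`,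
`preservesGeomSubgroup_of_geomCompatibleOfAnabelomorphism`); (iv) relabelling (E-t1's `Aut(Π)`-action, Prop. 5.9.1 (2)) moves the
geometric subgroup by `σ` (`geomSubgroup_relabel`), so clause (6)(b) is invariant under every `σ` preserving `Δ^temp_X`
(`geomCompatible_relabel_iff`) — in particular under INNER automorphisms (`map_conjEquiv_deltaTemp`,
`geomCompatible_relabel_conj_iff`, pointed: `ATSObjPointed.geomCompatible_relabel_conj_iff`): (6)(b) descends to E-t21's
`Out(Π)`-orbits / isomorphism classes of Prop. 5.10.1.

NOT here: [Mochizuki 2004, Lemma 1.3.8] itself (FACT-LIST F-0007 shape `Literature.AnabelianGeometry.AbsoluteAnabelian.PreservesGeom`,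
consumed by name elsewhere, never asserted here); any judgement. No `Cor312*`/`Thm311*` import (E-PLAN R14). Unrefereed preprint —
indexed ≠ endorsed; typed ≠ proved; no side taken on [IUTchIII] Cor. 3.12 or on any author.
-/

set_option autoImplicit false

noncomputable section

namespace Summit.ABC.IUTFork.Joshi

open Literature.AnabelianGeometry.SemiGraphs (TemperedCurve)

variable {p : ℕ} [Fact p.Prime] {X : TemperedCurve p}

/-! ## 1. Unpointed side (E-t19 `ATSObj.GeomCompatible` ↔ E-t21 `ATSObj.PreservesGeomSubgroup`; relabelling) -/

namespace ATSObj

/-- E-t19's Rmk. 5.1.2 (∀ objects of `𝔍(X,E)`) gives E-t21's Prop. 5.8.1 (2) input on `𝔍_hyp(X,E)` for EVERY hyperbolicity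
predicate `IsHyp` (audit note N3 on p431517: «one line»). [folklore] -/
theorem preservesGeomSubgroup_of_geomCompatibleOfAnabelomorphism (IsHyp : TemperedCurve p → Prop)
    (h : GeomCompatibleOfAnabelomorphism X) : PreservesGeomSubgroup IsHyp X :=
  fun _ A _ => h A

/-- At the trivial predicate (`𝔍_hyp = 𝔍`) the two ∀-forms coincide. [folklore] -/
theorem geomCompatibleOfAnabelomorphism_iff_preservesGeomSubgroup :
    GeomCompatibleOfAnabelomorphism X ↔ PreservesGeomSubgroup (fun _ => True) X := by
  constructor
  · intro h _ A _
    exact h A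
  · intro h A
    exact h trivial A (mem_subcat_iff.2 trivial)

/-- Relabelling by `σ ∈ Aut(Π^temp_X)` (E-t1's `relabel`, Prop. 5.9.1 (2)) moves «the geometric subgroup provided by the object»
by `σ`: `geomSubgroup (σ · A) = σ(geomSubgroup A)`. [folklore] -/
theorem geomSubgroup_relabel (σ : X.PiTemp ≃ₜ* X.PiTemp) (A : ATSObj X) :
    (relabel σ A).geomSubgroup = A.geomSubgroup.map σ.toMonoidHom := by
  ext x
  simp only [geomSubgroup, Subgroup.mem_map]
  constructor
  · rintro ⟨y, hy, rfl⟩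
    exact ⟨A.α y, ⟨y, hy, rfl⟩, rfl⟩
  · rintro ⟨_, ⟨y, hy, rfl⟩, rfl⟩
    exact ⟨y, hy, rfl⟩

/-- Clause (6)(b) is invariant under relabelling by any `σ` that carries `Δ^temp_X` onto itself. [folklore] -/
theorem geomCompatible_relabel_iff {σ : X.PiTemp ≃ₜ* X.PiTemp} (hσ : X.DeltaTemp.map σ.toMonoidHom = X.DeltaTemp)
    (A : ATSObj X) : (relabel σ A).GeomCompatible ↔ A.GeomCompatible := by
  rw [geomCompatible_iff, geomCompatible_iff, geomSubgroup_relabel]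
  constructor
  · intro h
    exact Subgroup.map_injective σ.injective (h.trans hσ.symm)
  · intro h
    rw [h, hσ]

/-- `Δ^temp_X = ker(aug)` is normal, hence carried onto itself by every inner automorphism (E-t21's `conjEquiv g`). [folklore] -/
theorem map_conjEquiv_deltaTemp (g : X.PiTemp) : X.DeltaTemp.map (conjEquiv g).toMonoidHom = X.DeltaTemp := by
  haveI : X.DeltaTemp.Normal := MonoidHom.normal_ker _
  ext x
  simp only [Subgroup.mem_map]
  constructor
  · rintro ⟨y, hy, rfl⟩
    show conjEquiv g y ∈ X.DeltaTemp
    rw [conjEquiv_apply]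
    exact Subgroup.Normal.conj_mem inferInstance y hy g
  · intro hx
    refine ⟨g⁻¹ * x * g⁻¹⁻¹, Subgroup.Normal.conj_mem inferInstance x hx g⁻¹, ?_⟩
    show conjEquiv g _ = x
    rw [conjEquiv_apply, inv_inv]
    group

/-- Clause (6)(b) is invariant under INNER relabellings: it descends to the `Out(Π)`-orbits / isomorphism classes of
Prop. 5.10.1 (E-t21's `isIso_relabel_conj`, `relabelClass_conj`). [folklore] -/
theorem geomCompatible_relabel_conj_iff (A : ATSObj X) (g : X.PiTemp) :
    (relabel (conjEquiv g) A).GeomCompatible ↔ A.GeomCompatible :=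
  geomCompatible_relabel_iff (map_conjEquiv_deltaTemp g) A

/-- Under E-t19's Rmk. 5.1.2 every relabelled object still satisfies (6)(b) (trivially, the ∀-form), so the `Aut(Π)`-action of
Prop. 5.9.1 (2) stays inside the (6)(b)-objects. [folklore] -/
theorem geomCompatible_relabel_of_geomCompatibleOfAnabelomorphism (h : GeomCompatibleOfAnabelomorphism X)
    (σ : X.PiTemp ≃ₜ* X.PiTemp) (A : ATSObj X) : (relabel σ A).GeomCompatible :=
  h _

end ATSObj

/-! ## 2. Pointed side (E-t1 `ATSObjPointed.GeomCompatible` / `Rmk512` ↔ E-t19 `ATSObj.GeomCompatible` / `GeomCompatibleOfAnabelomorphism`) -/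

namespace ATSObjPointed

variable {𝔅 : ∀ Y : TemperedCurve p, ATS1.BerkovichDatum Y} {F : Type} [NormedField F] [CompleteSpace F] [IsUltrametricDist F]
  [IsAlgClosed F] [CharP F p]

/-- Pointed (6)(b) (E-t1) IS unpointed (6)(b) (E-t19) of the base-point-free shadow — the same term. [folklore] -/
theorem geomCompatible_iff_toATSObj (A : ATSObjPointed X 𝔅 F) : A.GeomCompatible ↔ A.toATSObj.GeomCompatible :=
  Iff.rfl

/-- E-t19's Rmk. 5.1.2 (∀ objects of E-t1's `𝔍(X,E)`) ⟹ E-t1's pointed Rmk. 5.1.2 for EVERY Berkovich family `𝔅` and tilt base `F`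
(the gen-0 note «rmk512_of_geomCompatibleOfAnabelomorphism»). [folklore] -/
theorem rmk512_of_geomCompatibleOfAnabelomorphism (h : ATSObj.GeomCompatibleOfAnabelomorphism X) : Rmk512 X 𝔅 F :=
  fun A => (geomCompatible_iff_toATSObj A).2 (h A.toATSObj)

/-- Conversely, E-t1's pointed Rmk. 5.1.2 over ONE `(𝔅, F)` gives E-t19's ∀-form as soon as every base-point-free object lifts to a
pointed one over that `(𝔅, F)` (explicit hypothesis: a holomorphic structure on `Y` with the given untilt and embedding, tilt base
`F` — print fixes no `F` for `𝔍(X,E)`, only for `𝔍(X,E)_F`, Def. 5.6.2). [folklore] -/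
theorem geomCompatibleOfAnabelomorphism_of_rmk512 (h : Rmk512 X 𝔅 F)
    (lift : ∀ A : ATSObj X, ∃ P : ATSObjPointed X 𝔅 F, P.toATSObj = A) : ATSObj.GeomCompatibleOfAnabelomorphism X := by
  intro A
  obtain ⟨P, rfl⟩ := lift A
  exact (geomCompatible_iff_toATSObj P).1 (h P)

/-- On the objects that DO lift, pointed Rmk. 5.1.2 already decides (6)(b) of the shadow. [folklore] -/
theorem toATSObj_geomCompatible_of_rmk512 (h : Rmk512 X 𝔅 F) (P : ATSObjPointed X 𝔅 F) : P.toATSObj.GeomCompatible :=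
  (geomCompatible_iff_toATSObj P).1 (h P)

/-- Pointed (6)(b) is invariant under inner relabellings (E-t1's `ATSObjPointed.relabel`, which commutes with the shadow). [folklore] -/
theorem geomCompatible_relabel_conj_iff (A : ATSObjPointed X 𝔅 F) (g : X.PiTemp) :
    (A.relabel (ATSObj.conjEquiv g)).GeomCompatible ↔ A.GeomCompatible := by
  rw [geomCompatible_iff_toATSObj, geomCompatible_iff_toATSObj, toATSObj_relabel]
  exact ATSObj.geomCompatible_relabel_conj_iff _ g

/-- The two typings of the SELF object agree: E-t1's `self_geomCompatible` is E-t19's `geomCompatible_self` read through the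
shadow (`self_toATSObj`). [folklore] -/
theorem self_toATSObj_geomCompatible (S : ATS1.ArithHolStructure X (𝔅 X) F) : (self S).toATSObj.GeomCompatible :=
  (geomCompatible_iff_toATSObj _).1 (self_geomCompatible S)

end ATSObjPointed

end Summit.ABC.IUTFork.Joshi

end
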